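import Summits.QuantumFields.BalabanUV.T4Continuum.Spine.NE2.ComposedRemainderCoherentTowerDeltaPrime
import Summits.QuantumFields.BalabanUV.T4Continuum.Spine.NE2.TorusBlockAverageSize
import Literature.MathematicalPhysics.QuantumFieldTheory.Balaban1983to89.B14FlowStep

/-!
# T⁴ programme, spine node NE2 (U1a) — F6 (ζ) on the route's carriers, file 5: THE SIZE LETTERS OF A COHERENT AVERAGED TOWER FROM THE FINEST LEVEL, AND THE END WITH TOP-LEVEL LETTERS ONLY
# (cell `pub-balaban-gaps`, seat ne2 gen 7; after `TorusBlockAverageSize` (file 4) and `ComposedRemainderCoherentTowerDeltaPrime`)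

`…CoherentTowerDeltaPrime.composed_full_averaging_deltaPrime_rate_of_coherentTowers` still displays a SIZE letter `‖u_k^{(i)} − 1‖ ≤ α_U/L^i` at EVERY level `i`.  For coherent towers
the levels are averages of the finest field, and file 4's one-step bound `‖V̄ − 1‖ ≤ (e^{4θ} − 1) + ((1 + a)^L − 1)` is SCALE-COVARIANT to first order (`(1 + a)^L − 1 ≈ L·a`: a bond of the
coarse lattice is `L` fine bonds) with a second-order loop correction controlled by the PLAQUETTE letters of file 2 (`tplaq_tower_le`).  THIS FILE iterates it:
 * §1 real bookkeeping (`e^t − 1 ≤ t(1+2t)` on `[0, ½]` via `B14FlowStep.exp_le_one_add_two_mul`, the budget `G_i = α_U + (2Ā² + 2Kp_U)·Σ_{i≤j<k} L^{−j} ≤ Ā := 2α_U + 8Kp_U` under `Ā ≤ 1/8`, `K = 64(d+1)(d+4)`);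
 * §2 **`sizes_tower_le`**: COHERENT tower of contractive-unit-valued configurations, TOP size `‖V_k − 1‖ ≤ α_U·L^{−k}`, TOP plaquette letter `p_U·L^{−2k}` (`8C₀′p_U ≤ 1`), `Ā ≤ 1/8`
   ⟹ at EVERY level `i ≤ k`: **`‖V_i − 1‖ ≤ Ā·L^{−i}`**;
 * §3 **`composed_full_averaging_deltaPrime_rate_of_coherentTowers_top`** — the END of `…CoherentTowerDeltaPrime` with the per-level size hypothesis `hUa` REPLACED by the finest level's
   size letter (`sizes_of_coherent`; `α_U ↦ Ā` in the constants): about the TOWERS the END now displays only FINEST-LEVEL letters (size `α_U`, lattice-Lipschitz `β_U`, plaquette `p_U`) +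
   the chain closeness `σ_U, θ_c` (a two-problem comparison = node NE3's currency) + the six `Δ′` field letters + `Y_x ∈ P`; + `_flat`-type non-vacuity is inherited (all letters `0`).
HONEST FRAMING (T4-DAG p. 1).  Elementary iteration of tree-PROVED estimates on MODEL carriers; `u`, the frame are DATA; NE3 OPEN by name; NOT NE2; **NE2 (U1a) NOT PROVED**; spine PROVED 0/9
unchanged; NOT continuum YM / infinite volume / mass gap / Clay.  No `sorry`.
-/

noncomputable section

open scoped BigOperators ComplexConjugate Matrix Matrix.Norms.L2Operator Kronecker
open Finset (range)

namespace Summit.QuantumFields.BalabanUV.T4Continuum.NE2.ComposedRemainderCoherentTowerSizes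

open Literature.MathematicalPhysics.QuantumFieldTheory.Balaban1983to89
open Literature.MathematicalPhysics.QuantumFieldTheory.Balaban1983to89.B7Prop1Explicit (Site U1)
open Literature.MathematicalPhysics.QuantumFieldTheory.Balaban1983to89.B5Prop11Plancherel (Tor fine unitVec Cst)
open Literature.MathematicalPhysics.QuantumFieldTheory.Balaban1983to89.B5G183RateUnitTower (lev lev_neZero)
open Literature.MathematicalPhysics.QuantumFieldTheory.Balaban1983to89.T4EtaRateMin (LocalRate)
open Literature.MathematicalPhysics.QuantumFieldTheory.Balaban1983to89.T4AxialChain (one_add_pow_le_exp)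
open Literature.MathematicalPhysics.QuantumFieldTheory.Balaban1983to89.B9Eq373V3 (exp_sub_one_le_mul_exp_of_le)
open Literature.MathematicalPhysics.QuantumFieldTheory.Balaban1983to89.B14FlowStep (exp_le_one_add_two_mul)
open Summit.QuantumFields.BalabanUV.Beta.AdjointCarrierWiringEnd (CompFamily)
open Summit.QuantumFields.BalabanUV.T4Continuum
open Summit.QuantumFields.BalabanUV.T4Continuum.BalabanAveragedTowerUnit (idx Qlev cast_lev')
open Summit.QuantumFields.BalabanUV.T4Continuum.BalabanAveragedTowerModes (par)
open Summit.QuantumFields.BalabanUV.T4Continuum.BlockPairingGeometry (tau)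
open Summit.QuantumFields.BalabanUV.T4Continuum.KingPairingPlantedLaw (JpcT calDalev CJ)
open Summit.QuantumFields.BalabanUV.T4Continuum.GramPerturbationLaw (C2gram)
open Summit.QuantumFields.BalabanUV.T4Continuum.CovariantAveragingTower (TowerLimitRate)
open Summit.QuantumFields.BalabanUV.T4Continuum.BackgroundResolventTower (PerturbationLaws Cpert)
open Summit.QuantumFields.BalabanUV.T4Continuum.RegularBackgroundTower (RegularTransporters regClass)
open Summit.QuantumFields.BalabanUV.T4Continuum.NE2FromNE3 (bgReadings)
open Summit.QuantumFields.BalabanUV.T4Continuum.CovariantAveragingSummand (kappaQ)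
open Summit.QuantumFields.BalabanUV.T4Continuum.NE2BalabanLayer (tierBPert kappaB C2B)
open Summit.QuantumFields.BalabanUV.T4Continuum.NE2.CovariantTableBalaban (TBal)
open Summit.QuantumFields.BalabanUV.T4Continuum.NE2.ComposedAveragingMean (thetaZero geom_sum_le_two inv_le_half)
open Summit.QuantumFields.BalabanUV.T4Continuum.NE2.ComposedAveragingRemainder (avgPertFull)
open Summit.QuantumFields.BalabanUV.T4Continuum.NE2.ComposedRemainderTower (Erem cR)
open Summit.QuantumFields.BalabanUV.T4Continuum.NE2.OneStepRemainderLoopCoeff (YxT remCoeffOf)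
open Summit.QuantumFields.BalabanUV.T4Continuum.NE2.ComposedRemainderGaugeTower (fundT adT)
open Summit.QuantumFields.BalabanUV.T4Continuum.NE2.ComposedRemainderRateLetters (GamU EU CrU inv_lev_eq)
open Summit.QuantumFields.BalabanUV.T4Continuum.NE2.ComposedRemainderGaugeTowerRegular (topAdT)
open Summit.QuantumFields.BalabanUV.T4Continuum.NE2.TorusBlockAveragePlaquette (bavgTor tplaq)
open Summit.QuantumFields.BalabanUV.T4Continuum.NE2.TorusAveragedTowerPlaquette (C0' tplaq_tower_le)
open Summit.QuantumFields.BalabanUV.T4Continuum.NE2.TorusBlockAverageSize (norm_bavgTor_sub_one_le)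
open Summit.QuantumFields.BalabanUV.T4Continuum.NE2.ComposedRemainderCoherentTower (liftU liftU_one mem_U1_of_unitary tplaq_one)
open Summit.QuantumFields.BalabanUV.T4Continuum.NE2.ComposedRemainderGaugeTowerFlat (flatU fundT_flatU)
open Summit.QuantumFields.BalabanUV.T4Continuum.NE2.ComposedRemainderGaugeTowerRegular (topAdT_flat)
open Summit.QuantumFields.BalabanUV.T4Continuum.NE2.OneStepRemainderLoopFlat (YxT_one)
open Summit.QuantumFields.BalabanUV.T4Continuum.NE2BalabanFlatWitness (localRate_flat)
open Summit.QuantumFields.BalabanUV.T4Continuum.RegularBackgroundTower (betaNE3)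
open Summit.QuantumFields.BalabanUV.T4Continuum.ColourCovariantLaplacian (kappaCol)
open Summit.QuantumFields.BalabanUV.T4Continuum.NE2.TorusAveragedTowerPlaquette (coherent_flat)
open Summit.QuantumFields.BalabanUV.T4Continuum.NE2.DeltaPrimeHodgeRate (kappaDP2)
open Summit.QuantumFields.BalabanUV.T4Continuum.NE2.DeltaPrimeOperator (deltaPrime)
open Summit.QuantumFields.BalabanUV.T4Continuum.NE2.DeltaPrimeCatalogue (Bfield)
open Summit.QuantumFields.BalabanUV.T4Continuum.NE2.DeltaPrimeSecondOrder (Sfield kappaDP CDP)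
open Summit.QuantumFields.BalabanUV.T4Continuum.NE2.ComposedRemainderCoherentTowerDeltaPrime (topU composed_full_averaging_deltaPrime_rate_of_coherentTowers)

variable {d : ℕ}

/-! ## §1 Real bookkeeping -/

/-- `e^t − 1 ≤ t(1 + 2t)` for `0 ≤ t ≤ ½`. [folklore] -/
theorem exp_sub_one_le_of_small {t : ℝ} (h0 : 0 ≤ t) (h1 : t ≤ 1 / 2) : Real.exp t - 1 ≤ t * (1 + 2 * t) :=
  (exp_sub_one_le_mul_exp_of_le h0 le_rfl).trans (mul_le_mul_of_nonneg_left (exp_le_one_add_two_mul h0 h1) h0)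

/-- the loop constant `K = 64(d+1)(d+4)` (`4θ` per unit of `L²α₀`). [folklore] -/
def Kloop (d : ℕ) : ℝ := 64 * (d + 1) * (d + 4)

/-- the propagated size constant `Ā = 2α_U + 8K·p_U`. [folklore] -/
def Abar (d : ℕ) (αU pU : ℝ) : ℝ := 2 * αU + 8 * Kloop d * pU

/-- the size budget at level `i`: `G_i = α_U + (2Ā² + 2Kp_U)·Σ_{i ≤ j < k} y^j`. [folklore] -/
def budG (d : ℕ) (αU pU y : ℝ) (k i : ℕ) : ℝ := αU + (2 * Abar d αU pU ^ 2 + 2 * Kloop d * pU) * ∑ j ∈ Finset.Ico i k, y ^ j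

/-- `0 ≤ K`. [folklore] -/
theorem Kloop_nonneg : 0 ≤ Kloop d := by unfold Kloop; positivity

/-- `G_k = α_U`. [folklore] -/
theorem budG_top (αU pU y : ℝ) (k : ℕ) : budG d αU pU y k k = αU := by
  unfold budG; rw [Finset.Ico_self, Finset.sum_empty, mul_zero, add_zero]

/-- the recursion `G_i = G_{i+1} + (2Ā² + 2Kp_U)·y^i` (`i < k`). [folklore] -/
theorem budG_step (αU pU y : ℝ) {k i : ℕ} (hik : i < k) : budG d αU pU y k i = budG d αU pU y k (i + 1) + (2 * Abar d αU pU ^ 2 + 2 * Kloop d * pU) * y ^ i := by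
  unfold budG; rw [Finset.sum_eq_sum_Ico_succ_bot hik]; ring

/-- **THE BUDGET IS BOUNDED**: `G_i ≤ Ā` for `0 ≤ y ≤ ½` under `Ā ≤ 1/8`. [folklore] -/
theorem budG_le_Abar {αU pU y : ℝ} (hαU : 0 ≤ αU) (hpU : 0 ≤ pU) (hy0 : 0 ≤ y) (hy : y ≤ 1 / 2) (hA : Abar d αU pU ≤ 1 / 8) (k i : ℕ) : budG d αU pU y k i ≤ Abar d αU pU := by
  have hK := Kloop_nonneg (d := d)
  have hs : ∑ j ∈ Finset.Ico i k, y ^ j ≤ 2 := by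
    calc ∑ j ∈ Finset.Ico i k, y ^ j ≤ ∑ j ∈ Finset.range k, y ^ j := by
          rw [Finset.range_eq_Ico]
          exact Finset.sum_le_sum_of_subset_of_nonneg (Finset.Ico_subset_Ico (Nat.zero_le i) le_rfl) fun j _ _ => pow_nonneg hy0 j
      _ ≤ 2 := by linarith [geom_sum_le_two hy0 hy k, pow_nonneg hy0 k]
  have hA0 : 0 ≤ Abar d αU pU := by unfold Abar; positivity
  unfold budG
  have h1 : (2 * Abar d αU pU ^ 2 + 2 * Kloop d * pU) * ∑ j ∈ Finset.Ico i k, y ^ j ≤ (2 * Abar d αU pU ^ 2 + 2 * Kloop d * pU) * 2 :=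
    mul_le_mul_of_nonneg_left hs (by positivity)
  have h2 : 4 * Abar d αU pU ^ 2 ≤ Abar d αU pU / 2 := by nlinarith
  have h3 : αU + 4 * Kloop d * pU = Abar d αU pU / 2 := by unfold Abar; ring
  nlinarith

/-- `0 ≤ G_i`. [folklore] -/
theorem budG_nonneg {αU pU y : ℝ} (hαU : 0 ≤ αU) (hpU : 0 ≤ pU) (hy0 : 0 ≤ y) (k i : ℕ) : 0 ≤ budG d αU pU y k i := by
  unfold budG; have := Kloop_nonneg (d := d); have := Finset.sum_nonneg (fun j (_ : j ∈ Finset.Ico i k) => pow_nonneg hy0 j); positivity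

/-! ## §2 The size letters of a coherent tower from the finest level -/

section Tower

variable {𝔸 : Type*} [NormedRing 𝔸] [NormOneClass 𝔸] [NormedAlgebra ℂ 𝔸] [CompleteSpace 𝔸]
variable (L : ℕ) [NeZero L] (M : Fin d → ℕ) [hM : ∀ μ, NeZero (M μ)]

/-- **THE SIZE LETTERS OF A COHERENT AVERAGED TOWER FROM THE FINEST LEVEL**: for a coherent tower `V_i = V̄[V_{i+1}]` (`i < k`) of contractive-unit-valued configurations with TOP size
`‖V_k − 1‖ ≤ α_U·(L⁻¹)^k`, TOP plaquette letter `p_U·(L⁻²)^k`, `8C₀′p_U ≤ 1` and `Ā = 2α_U + 8Kp_U ≤ 1/8`, EVERY level satisfies `‖V_i − 1‖ ≤ Ā·(L⁻¹)^i` (`i ≤ k`, `L ≥ 2`).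
[cite: Balaban1985Averaging, (42) p.23, Prop. 1 (51) p.26 (iterated)] [folklore] -/
theorem sizes_tower_le (hL : 2 ≤ L) (k : ℕ) (V : (i : ℕ) → Tor (fine (lev L i) M) → Fin d → 𝔸ˣ) (hV : ∀ i y κ, V i y κ ∈ U1 𝔸)
    (hcoh : ∀ i, i < k → V i = bavgTor (lev L i) L M (V (i + 1))) {αU pU : ℝ} (hαU : 0 ≤ αU) (hpU : 0 ≤ pU) (hth : 8 * C0' d * pU ≤ 1) (hA : Abar d αU pU ≤ 1 / 8)
    (htop : ∀ (y : Tor (fine (lev L k) M)) (μ ν : Fin d), μ ≠ ν → ‖((tplaq (V k) y μ ν : 𝔸ˣ) : 𝔸) - 1‖ ≤ pU * (((L : ℝ)⁻¹) ^ 2) ^ k)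
    (htopA : ∀ (y : Tor (fine (lev L k) M)) (κ : Fin d), ‖((V k y κ : 𝔸ˣ) : 𝔸) - 1‖ ≤ αU * ((L : ℝ)⁻¹) ^ k)
    {i : ℕ} (hi : i ≤ k) (y : Tor (fine (lev L i) M)) (κ : Fin d) :
    ‖((V i y κ : 𝔸ˣ) : 𝔸) - 1‖ ≤ Abar d αU pU * ((L : ℝ)⁻¹) ^ i := by
  obtain ⟨h0, h2⟩ := inv_le_half hL
  have hL1 : 1 ≤ L := by omega
  have hLr : (0 : ℝ) < L := by exact_mod_cast (by omega : 0 < L)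
  set yy : ℝ := (L : ℝ)⁻¹ with hyy
  set x : ℝ := yy ^ 2 with hx
  have hx0 : 0 ≤ x := pow_nonneg h0 2
  have hLx : (L : ℝ) ^ 2 * x = 1 := by rw [hx, ← mul_pow, mul_inv_cancel₀ hLr.ne', one_pow]
  have hLy : (L : ℝ) * yy = 1 := mul_inv_cancel₀ hLr.ne'
  have hK := Kloop_nonneg (d := d)
  have hA0 : 0 ≤ Abar d αU pU := by unfold Abar; positivity
  have hKp : Kloop d * pU ≤ 1 / 64 := by unfold Abar at hA; nlinarith
  have hd0 : (0 : ℝ) ≤ d := Nat.cast_nonneg d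
  -- Prop-1 smallness at every level from `8C₀′p_U ≤ 1`
  have hS : 2 * (512 * (d + 1) * (d + 4) : ℝ) * pU ≤ 1 := by
    have hC2 : 2 * (512 * (d + 1) * (d + 4) : ℝ) * pU ≤ 8 * C0' d * pU := by
      unfold C0'
      set t : ℝ := ((d : ℝ) + 1) * ((d : ℝ) + 4) with ht
      have ht1 : 1 ≤ t := by rw [ht]; nlinarith
      have : 2 * (512 * ((d : ℝ) + 1) * (d + 4)) ≤ 8 * (226 * (8 * ((d : ℝ) + 1) * (d + 4)) ^ 2) := by
        calc 2 * (512 * ((d : ℝ) + 1) * (d + 4)) = 1024 * t := by rw [ht]; ring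
          _ ≤ 115712 * t ^ 2 := by nlinarith
          _ = 8 * (226 * (8 * ((d : ℝ) + 1) * (d + 4)) ^ 2) := by rw [ht]; ring
      exact mul_le_mul_of_nonneg_right this hpU
    linarith
  -- the plaquette letters of file 2 at every level
  have hq : ∀ j, j ≤ k → ∀ (z : Tor (fine (lev L j) M)) (μ ν : Fin d), μ ≠ ν → ‖((tplaq (V j) z μ ν : 𝔸ˣ) : 𝔸) - 1‖ ≤ 2 * pU * x ^ j :=
    fun j hj z μ ν hμν => tplaq_tower_le L M hL k V hV hcoh hpU hth htop hj z hμν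
  have hGA : ∀ j, budG d αU pU yy k j ≤ Abar d αU pU := fun j => budG_le_Abar hαU hpU h0 h2 hA k j
  -- downward induction with the budget `G_i`
  have key : ∀ n i, i + n = k → ∀ (y : Tor (fine (lev L i) M)) (κ : Fin d), ‖((V i y κ : 𝔸ˣ) : 𝔸) - 1‖ ≤ budG d αU pU yy k i * yy ^ i := by
    intro n
    induction n with
    | zero =>
      intro i hik y κ
      rw [add_zero] at hik; subst hik
      rw [budG_top]; exact htopA y κ
    | succ n ih =>
      intro i hik y κ
      have hik' : i < k := by omega
      have hI := ih (i + 1) (by omega)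
      haveI := lev_neZero L i
      -- letters at level i+1
      set G : ℝ := budG d αU pU yy k (i + 1) with hG
      have hG0 : 0 ≤ G := budG_nonneg hαU hpU h0 k (i + 1)
      have hGA1 : G ≤ Abar d αU pU := hGA (i + 1)
      set α₀ : ℝ := 2 * pU * x ^ (i + 1) with hα
      have hα0 : 0 ≤ α₀ := by positivity
      have hxi : x ^ i ≤ 1 := pow_le_one₀ hx0 (by rw [hx]; nlinarith)
      have hyi : yy ^ i ≤ 1 := pow_le_one₀ h0 (by linarith)
      have hsmall : 512 * (d + 1) * (d + 4) * (L : ℝ) ^ 2 * α₀ ≤ 1 := by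
        have e : 512 * (d + 1) * (d + 4) * (L : ℝ) ^ 2 * α₀ = 2 * (512 * (d + 1) * (d + 4) : ℝ) * pU * x ^ i := by
          rw [hα, pow_succ]; calc 512 * (d + 1) * (d + 4) * (L : ℝ) ^ 2 * (2 * pU * (x ^ i * x)) = 2 * (512 * (d + 1) * (d + 4) : ℝ) * pU * x ^ i * ((L : ℝ) ^ 2 * x) := by ring
            _ = _ := by rw [hLx, mul_one]
        rw [e]
        calc 2 * (512 * (d + 1) * (d + 4) : ℝ) * pU * x ^ i ≤ 2 * (512 * (d + 1) * (d + 4) : ℝ) * pU * 1 := mul_le_mul_of_nonneg_left hxi (by positivity)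
          _ ≤ 1 := by linarith
      have hstep := norm_bavgTor_sub_one_le L (lev L i) M hL1 (V (i + 1)) (hV (i + 1)) hα0 (a := G * yy ^ (i + 1)) (by positivity) hsmall
        (fun z μ ν hμν => hq (i + 1) (by omega) z μ ν hμν) (fun z κ' => hI z κ') y κ
      rw [hcoh i hik']
      refine hstep.trans ?_
      -- term A: the loop correction
      have eA : 4 * (8 * (d + 1) * (d + 4) * (L : ℝ) ^ 2 * α₀) = Kloop d * pU * x ^ i := by
        rw [hα, pow_succ]; unfold Kloop
        calc 4 * (8 * (d + 1) * (d + 4) * (L : ℝ) ^ 2 * (2 * pU * (x ^ i * x))) = 64 * (d + 1) * (d + 4) * pU * x ^ i * ((L : ℝ) ^ 2 * x) := by ring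
          _ = _ := by rw [hLx, mul_one]
      have hA_le : Real.exp (4 * (8 * (d + 1) * (d + 4) * (L : ℝ) ^ 2 * α₀)) - 1 ≤ 2 * Kloop d * pU * yy ^ i * yy ^ i := by
        rw [eA]
        have ht0 : 0 ≤ Kloop d * pU * x ^ i := by positivity
        have ht1 : Kloop d * pU * x ^ i ≤ 1 / 2 := by
          calc Kloop d * pU * x ^ i ≤ Kloop d * pU * 1 := mul_le_mul_of_nonneg_left hxi (by positivity)
            _ ≤ 1 / 2 := by linarith
        calc Real.exp (Kloop d * pU * x ^ i) - 1 ≤ Kloop d * pU * x ^ i * (1 + 2 * (Kloop d * pU * x ^ i)) := exp_sub_one_le_of_small ht0 ht1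
          _ ≤ Kloop d * pU * x ^ i * 2 := mul_le_mul_of_nonneg_left (by linarith) ht0
          _ = 2 * Kloop d * pU * yy ^ i * yy ^ i := by rw [hx, ← pow_mul, show 2 * i = i + i by ring, pow_add]; ring
      -- term B: the straight contour
      have hB_le : (1 + G * yy ^ (i + 1)) ^ L - 1 ≤ G * yy ^ i + 2 * Abar d αU pU ^ 2 * yy ^ i * yy ^ i := by
        have ht : (L : ℝ) * (G * yy ^ (i + 1)) = G * yy ^ i := by
          rw [pow_succ]; calc (L : ℝ) * (G * (yy ^ i * yy)) = G * yy ^ i * ((L : ℝ) * yy) := by ring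
            _ = _ := by rw [hLy, mul_one]
        have ht0 : 0 ≤ G * yy ^ i := by positivity
        have ht1 : G * yy ^ i ≤ 1 / 2 := by
          calc G * yy ^ i ≤ Abar d αU pU * 1 := mul_le_mul hGA1 hyi (pow_nonneg h0 i) hA0
            _ ≤ 1 / 2 := by linarith
        calc (1 + G * yy ^ (i + 1)) ^ L - 1 ≤ Real.exp ((L : ℝ) * (G * yy ^ (i + 1))) - 1 := by linarith [one_add_pow_le_exp (by positivity : 0 ≤ G * yy ^ (i + 1)) L]
          _ = Real.exp (G * yy ^ i) - 1 := by rw [ht]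
          _ ≤ G * yy ^ i * (1 + 2 * (G * yy ^ i)) := exp_sub_one_le_of_small ht0 ht1
          _ = G * yy ^ i + 2 * G ^ 2 * yy ^ i * yy ^ i := by ring
          _ ≤ G * yy ^ i + 2 * Abar d αU pU ^ 2 * yy ^ i * yy ^ i := by
              have : G ^ 2 ≤ Abar d αU pU ^ 2 := pow_le_pow_left₀ hG0 hGA1 2
              have : 0 ≤ yy ^ i * yy ^ i := by positivity
              nlinarith
      calc Real.exp (4 * (8 * (d + 1) * (d + 4) * (L : ℝ) ^ 2 * α₀)) - 1 + ((1 + G * yy ^ (i + 1)) ^ L - 1)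
          ≤ 2 * Kloop d * pU * yy ^ i * yy ^ i + (G * yy ^ i + 2 * Abar d αU pU ^ 2 * yy ^ i * yy ^ i) := add_le_add hA_le hB_le
        _ = (G + (2 * Abar d αU pU ^ 2 + 2 * Kloop d * pU) * yy ^ i) * yy ^ i := by ring
        _ = budG d αU pU yy k i * yy ^ i := by rw [budG_step (d := d) αU pU yy hik', hG]
  obtain ⟨n, rfl⟩ := Nat.exists_eq_add_of_le hi
  exact (key n i rfl y κ).trans (mul_le_mul_of_nonneg_right (hGA i) (pow_nonneg h0 i))

end Tower

/-! ## §3 The END with finest-level letters only -/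

section End

variable (L : ℕ) [NeZero L] (M : Fin d → ℕ) [hM : ∀ μ, NeZero (M μ)]
  {n : Type} [Fintype n] [DecidableEq n] {ι : Type} [Fintype ι] [DecidableEq ι] {c : ℝ} {P : Submodule ℝ (Matrix n n ℂ)} {e : ι → Matrix n n ℂ}
  (hF : CompFamily c P e) (a : ℝ) (ha : 0 < a) [Nonempty n] [Nonempty ι]

/-- **THE PER-LEVEL SIZE LETTERS OF THE END FROM THE FINEST LEVEL** (junk levels flat): `‖u_k^{(i)} − 1‖ ≤ Ā/L^i` at every `i`. [folklore] -/
theorem sizes_of_coherent (hL : 2 ≤ L) {u : ℕ → (i : ℕ) → Tor (fine (lev L i) M) → Fin d → (Matrix n n ℂ)ˣ}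
    (hu : ∀ k i y κ, ((u k i y κ : (Matrix n n ℂ)ˣ) : Matrix n n ℂ) ∈ Matrix.unitaryGroup n ℂ)
    (hcoh : ∀ k i, i < k → u k i = bavgTor (lev L i) L M (u k (i + 1))) (hjunk : ∀ k i, k < i → u k i = fun _ _ => 1)
    {αU pU : ℝ} (hαU : 0 ≤ αU) (hpU : 0 ≤ pU) (hth : 8 * C0' d * pU ≤ 1) (hA : Abar d αU pU ≤ 1 / 8)
    (htop : ∀ k (y : Tor (fine (lev L k) M)) (μ ν : Fin d), μ ≠ ν → ‖((tplaq (u k k) y μ ν : (Matrix n n ℂ)ˣ) : Matrix n n ℂ) - 1‖ ≤ pU * (((L : ℝ)⁻¹) ^ 2) ^ k)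
    (htopA : ∀ k (y : Tor (fine (lev L k) M)) (κ : Fin d), ‖((u k k y κ : (Matrix n n ℂ)ˣ) : Matrix n n ℂ) - 1‖ ≤ αU / (lev L k : ℕ))
    (k i : ℕ) (ν : Fin d) (b : idx L M i) : ‖(liftU L M u hu k i ν b : Matrix n n ℂ) - 1‖ ≤ Abar d αU pU / (lev L i : ℕ) := by
  rcases le_or_gt i k with hik | hik
  · have h := sizes_tower_le L M hL k (u k) (fun i y κ => mem_U1_of_unitary (hu k i y κ)) (hcoh k) hαU hpU hth hA (htop k)
      (fun y κ => by rw [← inv_lev_eq, ← div_eq_mul_inv]; exact htopA k y κ) hik b.1 ν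
    rw [← inv_lev_eq, ← div_eq_mul_inv] at h
    exact h
  · have hA0 : 0 ≤ Abar d αU pU := by unfold Abar; have := Kloop_nonneg (d := d); positivity
    have e1 : (liftU L M u hu k i ν b : Matrix n n ℂ) = 1 := by
      show ((u k i b.1 ν : (Matrix n n ℂ)ˣ) : Matrix n n ℂ) = 1
      rw [hjunk k i hik, Units.val_one]
    rw [e1, sub_self, norm_zero]; positivity

/-- **THE (3.26)-SHAPE END FOR COHERENT AVERAGED TOWERS, FINEST-LEVEL LETTERS**: `composed_full_averaging_deltaPrime_rate_of_coherentTowers` with the per-level size hypothesis REPLACED by the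
finest level's size letter `‖u_k^{(k)} − 1‖ ≤ α_U/L^k` (+ `Ā = 2α_U + 8Kp_U ≤ 1/8`); `α_U ↦ Ā` in the constants.  About the towers the END displays: coherence/junk, FINEST-LEVEL size `α_U`,
lattice-Lipschitz `β_U` and plaquette `p_U` letters, the chain closeness `σ_U, θ_c` (NE3's currency), the six `Δ′` field letters, `Y_x ∈ P`; plus the frame, NE3 BY NAME, `ρ`, thresholds and ONE
closed-form smallness inequality.
[cite: Balaban1985BackgroundPropagators, (3.10) p.392, (3.15)–(3.16) p.393, (3.26) p.395, (3.35)–(3.36) pp.396–397; Balaban1985Averaging, (15) p.19, (42) p.23, Prop. 1 (51) p.26, (124) p.36, (143) p.39; King1986, Lemma 4.5 (4.38) p.674 (method)] [folklore] -/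
theorem composed_full_averaging_deltaPrime_rate_of_coherentTowers_top (hL : 2 ≤ L) (hd : 1 ≤ d)
    {u : ℕ → (i : ℕ) → Tor (fine (lev L i) M) → Fin d → (Matrix n n ℂ)ˣ} (hu : ∀ k i y κ, ((u k i y κ : (Matrix n n ℂ)ˣ) : Matrix n n ℂ) ∈ Matrix.unitaryGroup n ℂ)
    (hcoh : ∀ k i, i < k → u k i = bavgTor (lev L i) L M (u k (i + 1))) (hjunk : ∀ k i, k < i → u k i = fun _ _ => 1)
    {αU βU σU θc ρ pU : ℝ} (hαU : 0 ≤ αU) (hβU : 0 ≤ βU) (hσU : 0 ≤ σU) (hθ0 : 0 ≤ θc) (hθ1 : θc ≤ 1) (hθρ : θc ≤ ρ) (hρ : 3 / (2 * (L : ℝ)) ≤ ρ) (hρ1 : ρ < 1)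
    (hpU : 0 ≤ pU) (hth : 8 * C0' d * pU ≤ 1) (hpUs : d * (2 * pU) ≤ 1 / 16) (hA : Abar d αU pU ≤ 1 / 8)
    (htop : ∀ k (y : Tor (fine (lev L k) M)) (μ ν : Fin d), μ ≠ ν → ‖((tplaq (u k k) y μ ν : (Matrix n n ℂ)ˣ) : Matrix n n ℂ) - 1‖ ≤ pU * (((L : ℝ)⁻¹) ^ 2) ^ k)
    (htopA : ∀ k (y : Tor (fine (lev L k) M)) (κ : Fin d), ‖((u k k y κ : (Matrix n n ℂ)ˣ) : Matrix n n ℂ) - 1‖ ≤ αU / (lev L k : ℕ))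
    (hUb : ∀ k ν μ (b : idx L M k), ‖(liftU L M u hu k k ν (tau (fine (lev L k) M) μ b) : Matrix n n ℂ) - (liftU L M u hu k k ν b : Matrix n n ℂ)‖ ≤ βU / ((lev L k : ℕ) : ℝ) ^ 2)
    (hUc : ∀ k i ν b, i ≤ k → ‖(liftU L M u hu (k + 1) i ν b : Matrix n n ℂ) - (liftU L M u hu k i ν b : Matrix n n ℂ)‖ ≤ σU * θc ^ k / (lev L i : ℕ))
    {C : ℝ} (hC : 0 ≤ C) (hNE3 : LocalRate (bgReadings L M (regClass L M (topAdT L M hF (liftU L M u hu)))) C ((L : ℝ)⁻¹))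
    (hYP : ∀ k i x μ r, YxT L M (fundT L M (liftU L M u hu k)) i x μ r ∈ P)
    {bS σS σS' bB σB σB' : ℝ} (hbS : 0 ≤ bS) (hσS : 0 ≤ σS) (hσS' : 0 ≤ σS') (hbB : 0 ≤ bB) (hσB : 0 ≤ σB) (hσB' : 0 ≤ σB')
    (hSb : ∀ k μ ν x, ‖Sfield (fine (lev L k) M) (lev L k) c e (fun ν x => (topU L M u hu k ν x : Matrix n n ℂ)) μ ν x‖ ≤ bS)
    (hSc : ∀ k μ ν (y : Tor (fine (lev L (k + 1)) M)), ‖Sfield (fine (lev L (k + 1)) M) (lev L (k + 1)) c e (fun ν x => (topU L M u hu (k + 1) ν x : Matrix n n ℂ)) μ ν y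
      - Sfield (fine (lev L k) M) (lev L k) c e (fun ν x => (topU L M u hu k ν x : Matrix n n ℂ)) μ ν (par (lev L k) L M y)‖ ≤ σS / (lev L k : ℕ))
    (hSl : ∀ k μ ν lam (x : Tor (fine (lev L k) M)), ‖Sfield (fine (lev L k) M) (lev L k) c e (fun ν x => (topU L M u hu k ν x : Matrix n n ℂ)) μ ν (x - unitVec _ lam)
      - Sfield (fine (lev L k) M) (lev L k) c e (fun ν x => (topU L M u hu k ν x : Matrix n n ℂ)) μ ν x‖ ≤ σS' / (lev L k : ℕ))
    (hBb : ∀ k μ ν x, ‖Bfield (fine (lev L k) M) (lev L k) c e (fun ν x => (topU L M u hu k ν x : Matrix n n ℂ)) μ ν x‖ ≤ bB)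
    (hBc : ∀ k μ ν (y : Tor (fine (lev L (k + 1)) M)), ‖Bfield (fine (lev L (k + 1)) M) (lev L (k + 1)) c e (fun ν x => (topU L M u hu (k + 1) ν x : Matrix n n ℂ)) μ ν y
      - Bfield (fine (lev L k) M) (lev L k) c e (fun ν x => (topU L M u hu k ν x : Matrix n n ℂ)) μ ν (par (lev L k) L M y)‖ ≤ σB / (lev L k : ℕ))
    (hBl : ∀ k μ ν lam (x : Tor (fine (lev L k) M)), ‖Bfield (fine (lev L k) M) (lev L k) c e (fun ν x => (topU L M u hu k ν x : Matrix n n ℂ)) μ ν (x - unitVec _ lam)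
      - Bfield (fine (lev L k) M) (lev L k) c e (fun ν x => (topU L M u hu k ν x : Matrix n n ℂ)) μ ν x‖ ≤ σB' / (lev L k : ℕ))
    (hsmall : kappaB ι d a (2 * Abar d αU pU) (2 * βU) C (kappaQ d a (a : ℂ) (Fintype.card ι * (Real.exp ((((d + 1) * L : ℕ) : ℝ) * (2 * Abar d αU pU)) - 1)
      + (1 + Fintype.card ι * (Real.exp ((((d + 1) * L : ℕ) : ℝ) * (2 * Abar d αU pU)) - 1)) * cR d L ι * GamU d (2 * pU) * Real.exp (EU ι d L (Abar d αU pU) (2 * pU)))) (kappaDP d a bS bB) < 1) :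
    TowerLimitRate (fun k => Qlev L M k ⊗ₖ (1 : Matrix ι ι ℂ)) ((L : ℝ) ^ d)
      (fun k => (calDalev L M a ha k ⊗ₖ (1 : Matrix ι ι ℂ)
        + tierBPert L M (topAdT L M hF (liftU L M u hu)) (avgPertFull L M a (fun k => TBal L M (adT L M hF (liftU L M u hu k)) k)
            (fun k => Erem L M (adT L M hF (liftU L M u hu k)) (remCoeffOf L M (fundT L M (liftU L M u hu k)) c e (adT L M hF (liftU L M u hu k))) k))
            (fun k => deltaPrime (fine (lev L k) M) (lev L k) c e (fun ν x => (topU L M u hu k ν x : Matrix n n ℂ))) k)⁻¹)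
      (Cpert (kappaB ι d a (2 * Abar d αU pU) (2 * βU) C (kappaQ d a (a : ℂ) (Fintype.card ι * (Real.exp ((((d + 1) * L : ℕ) : ℝ) * (2 * Abar d αU pU)) - 1)
          + (1 + Fintype.card ι * (Real.exp ((((d + 1) * L : ℕ) : ℝ) * (2 * Abar d αU pU)) - 1)) * cR d L ι * GamU d (2 * pU) * Real.exp (EU ι d L (Abar d αU pU) (2 * pU)))) (kappaDP d a bS bB)) (2 * d * Cst d a) (CJ d a)
        (C2B ι d L a (2 * Abar d αU pU) (2 * βU) C
          (a * C2gram (Cst d a) 1 (Fintype.card ι * (Real.exp ((((d + 1) * L : ℕ) : ℝ) * (2 * Abar d αU pU)) - 1)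
              + (1 + Fintype.card ι * (Real.exp ((((d + 1) * L : ℕ) : ℝ) * (2 * Abar d αU pU)) - 1)) * cR d L ι * GamU d (2 * pU) * Real.exp (EU ι d L (Abar d αU pU) (2 * pU))) (2 * d * Cst d a) (CJ d a) (Cst d a)
            (Cst d a * Fintype.card ι * (thetaZero d L (2 * Abar d αU pU) (2 * σU) + (Real.exp ((((d + 1) * L : ℕ) : ℝ) * (2 * Abar d αU pU)) - 1)) + CrU ι d L a (Abar d αU pU) σU (2 * pU)))
          (max (CDP d a bS (bS * (4 * Abar d αU pU) + (σS + σS') + bS * (4 * Abar d αU pU)) bB (bB * (4 * Abar d αU pU) + (σB + σB') + bB * (4 * Abar d αU pU))) 0)) 0 1) ρ := by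
  have hA0 : 0 ≤ Abar d αU pU := by unfold Abar; have := Kloop_nonneg (d := d); positivity
  exact composed_full_averaging_deltaPrime_rate_of_coherentTowers L M hF a ha hL hd hu hcoh hjunk hA0 hβU hσU hθ0 hθ1 hθρ hρ hρ1 hpU hth hpUs htop
    (sizes_of_coherent L M hL hu hcoh hjunk hαU hpU hth hA htop htopA) hUb hUc hC hNE3 hYP hbS hσS hσS' hbB hσB hσB' hSb hSc hSl hBb hBc hBl hsmall


/-! ## §4 Non-vacuity at the flat tower -/

include ha in
/-- **NON-VACUITY OF THE FINEST-LEVEL END**: the flat site-based tower `u ≡ 1` is coherent (`coherent_flat`) and flat above every top, its plaquettes are trivial, all letters vanish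
(`α_U = β_U = σ_U = θ_c = p_U = b_S = σ_S = σ_S′ = b_B = σ_B = σ_B′ = 0`, so `Ā = 0`; the `Δ′` fields `S`, `B` of the flat field are `0`), NE3's shape holds (`localRate_flat`) and the
smallness inequality reads `0 < 1`; so every displayed binder of `composed_full_averaging_deltaPrime_rate_of_coherentTowers_top` holds, for any component family, `L ≥ 2`, `d ≥ 1`,
`3/(2L) ≤ ρ < 1`.  NOT a statement about non-trivial data; NE2 NOT proved. [folklore] -/
theorem composed_full_averaging_deltaPrime_rate_of_coherentTowers_top_flat (hL : 2 ≤ L) (hd : 1 ≤ d) {ρ : ℝ} (hρ : 3 / (2 * (L : ℝ)) ≤ ρ) (hρ1 : ρ < 1) :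
    ∃ (u : ℕ → (i : ℕ) → Tor (fine (lev L i) M) → Fin d → (Matrix n n ℂ)ˣ) (hu : ∀ k i y κ, ((u k i y κ : (Matrix n n ℂ)ˣ) : Matrix n n ℂ) ∈ Matrix.unitaryGroup n ℂ) (Cp : ℝ),
      (∀ k i, i < k → u k i = bavgTor (lev L i) L M (u k (i + 1))) ∧
      TowerLimitRate (fun k => Qlev L M k ⊗ₖ (1 : Matrix ι ι ℂ)) ((L : ℝ) ^ d)
        (fun k => (calDalev L M a ha k ⊗ₖ (1 : Matrix ι ι ℂ)
          + tierBPert L M (topAdT L M hF (liftU L M u hu)) (avgPertFull L M a (fun k => TBal L M (adT L M hF (liftU L M u hu k)) k)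
              (fun k => Erem L M (adT L M hF (liftU L M u hu k)) (remCoeffOf L M (fundT L M (liftU L M u hu k)) c e (adT L M hF (liftU L M u hu k))) k))
              (fun k => deltaPrime (fine (lev L k) M) (lev L k) c e (fun ν x => (topU L M u hu k ν x : Matrix n n ℂ))) k)⁻¹) Cp ρ := by
  have hρ0 : 0 ≤ ρ := le_trans (by positivity) hρ
  set u : ℕ → (i : ℕ) → Tor (fine (lev L i) M) → Fin d → (Matrix n n ℂ)ˣ := fun _ _ _ _ => 1 with hudef
  have hu : ∀ k i y κ, ((u k i y κ : (Matrix n n ℂ)ˣ) : Matrix n n ℂ) ∈ Matrix.unitaryGroup n ℂ := fun _ _ _ _ => by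
    show (((1 : (Matrix n n ℂ)ˣ)) : Matrix n n ℂ) ∈ Matrix.unitaryGroup n ℂ
    rw [Units.val_one]; exact Submonoid.one_mem _
  have hcoh : ∀ k i, i < k → u k i = bavgTor (lev L i) L M (u k (i + 1)) := fun k i hik => coherent_flat L M k i hik
  have hlift : liftU L M u hu = fun _ => flatU L M := liftU_one L M hu
  have hone : ∀ (k i : ℕ) (ν : Fin d) (b : idx L M i), ((liftU L M u hu k i ν b : Matrix.unitaryGroup n ℂ) : Matrix n n ℂ) = 1 := fun _ _ _ _ => rfl
  have htopU : ∀ k, (fun ν x => ((topU L M u hu k ν x : Matrix.unitaryGroup n ℂ) : Matrix n n ℂ)) = fun (_ : Fin d) (_ : Tor (fine (lev L k) M)) => (1 : Matrix n n ℂ) := fun k => rfl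
  have hexp : Real.exp ((((d + 1) * L : ℕ) : ℝ) * (2 * 0)) - 1 = 0 := by rw [mul_zero, mul_zero, Real.exp_zero, sub_self]
  have hAb : Abar d 0 0 = 0 := by unfold Abar; ring
  have hG : GamU d (2 * 0) = 0 := by unfold GamU; rw [mul_zero, mul_zero]
  have hsmall : kappaB ι d a (2 * Abar d 0 0) (2 * 0) 0 (kappaQ d a (a : ℂ) (Fintype.card ι * (Real.exp ((((d + 1) * L : ℕ) : ℝ) * (2 * Abar d 0 0)) - 1)
      + (1 + Fintype.card ι * (Real.exp ((((d + 1) * L : ℕ) : ℝ) * (2 * Abar d 0 0)) - 1)) * cR d L ι * GamU d (2 * 0) * Real.exp (EU ι d L (Abar d 0 0) (2 * 0)))) (kappaDP d a 0 0) < 1 := by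
    rw [hAb, hexp, hG, mul_zero]
    simp [kappaB, kappaCol, kappaQ, betaNE3, kappaDP, kappaDP2]
  have hNE3 : LocalRate (bgReadings L M (regClass L M (topAdT L M hF (liftU L M u hu)))) 0 ((L : ℝ)⁻¹) := by
    rw [hlift, topAdT_flat]; exact localRate_flat L M le_rfl (inv_nonneg.mpr (Nat.cast_nonneg L))
  refine ⟨u, hu, _, hcoh, composed_full_averaging_deltaPrime_rate_of_coherentTowers_top L M hF a ha hL hd hu hcoh (fun _ _ _ => rfl)
    (αU := 0) (βU := 0) (σU := 0) (θc := 0) (pU := 0) le_rfl le_rfl le_rfl le_rfl zero_le_one hρ0 hρ hρ1 le_rfl (by rw [mul_zero]; norm_num) (by rw [mul_zero, mul_zero]; norm_num)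
    (by rw [hAb]; norm_num)
    (fun k y μ ν _ => by
      have e1 : ((tplaq (u k k) y μ ν : (Matrix n n ℂ)ˣ) : Matrix n n ℂ) = 1 := by rw [hudef, tplaq_one, Units.val_one]
      rw [e1, sub_self, norm_zero]; positivity)
    (fun k y κ => by rw [hudef, Units.val_one, sub_self, norm_zero]; positivity)
    (fun _ _ _ _ => by rw [hone, hone, sub_self, norm_zero]; positivity)
    (fun _ _ _ _ _ => by rw [hone, hone, sub_self, norm_zero]; positivity) le_rfl hNE3
    (fun _ i x μ r => by rw [hlift, fundT_flatU, YxT_one]; exact P.zero_mem)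
    (bS := 0) (σS := 0) (σS' := 0) (bB := 0) (σB := 0) (σB' := 0) le_rfl le_rfl le_rfl le_rfl le_rfl le_rfl
    (fun k μ ν x => by rw [htopU]; simp [Sfield]) (fun k μ ν y => by rw [htopU, htopU]; simp [Sfield]) (fun k μ ν lam x => by rw [htopU]; simp [Sfield])
    (fun k μ ν x => by rw [htopU]; simp [Bfield]) (fun k μ ν y => by rw [htopU, htopU]; simp [Bfield]) (fun k μ ν lam x => by rw [htopU]; simp [Bfield])
    hsmall⟩

end End

end Summit.QuantumFields.BalabanUV.T4Continuum.NE2.ComposedRemainderCoherentTowerSizes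

end
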